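import Literature.NumberTheory.Automorphic.UnitaryGroupTruncatedTraceClassExpansion
import Literature.NumberTheory.Automorphic.UnitaryGroupTruncatedKernelClassSumOfSupportTwo
import Literature.NumberTheory.Automorphic.UnitaryGroupTruncatedKernelClassIntegrableOfRowsTwo
import Literature.NumberTheory.Automorphic.UnitaryGroupLineUnipotentTwo
import Literature.NumberTheory.Automorphic.UnitaryGroupTruncatedKernelIntegrableCM
import Literature.NumberTheory.Automorphic.UnitaryGroupTruncatedKernelClassIntegrableHoldsTwo
import HarnessLib

/-!
# The coarse `𝔬`-expansion `J^T(f) = Σ_{𝔬 ∈ S_f} J^T_𝔬(f)` of Arthur's truncated trace for `U(J₂)` of a CM field,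
# from the per-class integrability of `k^T_𝔬` alone
(Rogawski, *Automorphic Representations of Unitary Groups in Three Variables* (1990), §2.2–2.3 pp. 13–14 «Then (2.1.1) is equal to
`Σ J^T_𝔬(f)`», for the rank-one groups `U(3)`, `U(2)`, `U(2) × U(1)` of §7.3 p. 98; Arthur, Duke Math. J. 45 (1978), Thm. 7.1;
Shokranian (1992), §5.2.)

Topic `NumberTheory/Automorphic`; namespace `Literature.NumberTheory.Automorphic.UnitaryGroup`. THEOREMS ONLY over accepted
tree modules: no definition, no named fact, no instance, no notation, no `sorry`. The `N = 2` sibling of ★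
`UnitaryGroupTruncatedTraceClassExpansion` (`truncatedTrace_eq_sum_truncatedTraceClass_charpoly_cm`) with the per-class integrability
left as the ONE binder `hint` (census Q5 «class rows first»: the `N = 2` LAW 1 class row — ★
`truncatedKernelClassIntegrable_cm_of_rows_two` + the Siegel closer of `UnitaryGroupTruncatedKernelClassIntegrableOfSiegelTwo` —
discharges it; the hypothesis-free form is the one-line ED. 2 of this file). Inputs at `N = 2`: the FINITE class sum ★
`truncatedKernel_eq_sum_truncatedKernelClass_of_tsupport_two` (`UnitaryGroupTruncatedKernelClassSumOfSupportTwo`), the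
fundamental-domain independence ★ `kernelBorelClass_eq_of_isFundamentalDomain_two` (`…ClassIntegrableOfRowsTwo` §0), and Tate's
compactly contained domain of `N(F)\N(𝔸_F)` in the line chart ★ `isFundamentalDomain_image_traceZeroFundamentalDomain_two` ∕
`exists_isCompact_image_traceZeroFundamentalDomain_subset_two` (`UnitaryGroupLineUnipotentTwo`). H-SIDE copy of LAWS 1–5
(`H = U(Φ₂) × U(Φ₁)`; LEAD WORDs #123∕#124; census `CENSUS-LAWS-Hside.F0P3a-p03g6.md` §3 LAW 3) of the T1 line
`Cruxes/H413/Lines/F0_T1InnerFormTraceIdentity.lean` (cell `pub/hodgecm-mathlib`, crux H413).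

* §1 `truncatedKernelClass_eq_of_isFundamentalDomain_two`, `truncatedTraceClass_eq_of_isFundamentalDomain_two` — `k^T_𝔬`, `J^T_𝔬` do
  not depend on `(ν, 𝓕)`.
* §2 **`truncatedTrace_eq_sum_truncatedTraceClass_charpoly_cm_two_of_integrable`** — THE COARSE `𝔬`-EXPANSION of `U(J₂)` at the CM pair
  for the characteristic-polynomial classes: a finite `S_f` and `T₀` with, for `T > T₀`, every `k^T_𝔬` (`𝔬 ∈ S_f`) integrable,
  `k^T = Σ_{𝔬 ∈ S_f} k^T_𝔬` pointwise and `J^T(f) = Σ_{𝔬 ∈ S_f} J^T_𝔬(f)`.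

## References

* J. D. Rogawski, *Automorphic Representations of Unitary Groups in Three Variables*, Ann. of Math. Stud. 123 (1990), §2.2–2.3 (pp. 13–14),
  §7.3 (p. 98) [Rogawski1990].
* J. Arthur, *A trace formula for reductive groups I*, Duke Math. J. 45 (1978), Thm. 7.1 [Arthur1978TraceFormulaI].
* S. Shokranian, *The Selberg–Arthur Trace Formula*, LNM 1503 (1992), §5.2 [Shokranian1992].
-/

set_option autoImplicit false

noncomputable section

open MeasureTheory Measure NumberField IsDedekindDomain Set Polynomial
open scoped NNReal ENNReal MatrixGroups

namespace Literature.NumberTheory.Automorphic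

namespace UnitaryGroup

variable {F E : Type} [Field F] [NumberField F] [Field E] [NumberField E] [Algebra F E]
  {c : E ≃ₐ[F] E} {ι : Type*}

/-! ## §1 The class objects of `U(J₂)` do not depend on `(ν, 𝓕)` -/

/-- **`k^T_𝔬` does not depend on `(ν, 𝓕)`** on `U(J₂)` (through ★ `kernelBorelClass_eq_of_isFundamentalDomain_two`:
`K_{B,𝔬}^{ν,𝓕} = K_{B,𝔬}^{ν',𝓕'}`). [cite: Rogawski1990, §2.2 (p. 13)] -/
theorem truncatedKernelClass_eq_of_isFundamentalDomain_two
    [MeasurableSpace (adelicUnipotent F E c 2)] [BorelSpace (adelicUnipotent F E c 2)]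
    (ν ν' : Measure (adelicUnipotent F E c 2)) [ν.IsHaarMeasure] [ν'.IsHaarMeasure]
    {𝓕 𝓕' : Set (adelicUnipotent F E c 2)}
    (h𝓕 : IsFundamentalDomain (rationalUnipotent F E c 2) 𝓕 ν)
    (h𝓕' : IsFundamentalDomain (rationalUnipotent F E c 2) 𝓕' ν')
    {cl : (quasiSplit F E c 2).arithmeticSubgroup → ι} (hclN : IsUnipotentInvariantOnBorel F E c 2 cl)
    (T : ℝ≥0) (i : ι) (f : (quasiSplit F E c 2).Adelic → ℂ) :
    truncatedKernelClass ν 𝓕 T cl i f = truncatedKernelClass ν' 𝓕' T cl i f := by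
  have hB : kernelBorelTailClass ν 𝓕 T cl i f = kernelBorelTailClass ν' 𝓕' T cl i f := by
    unfold kernelBorelTailClass
    rw [kernelBorelClass_eq_of_isFundamentalDomain_two ν ν' h𝓕 h𝓕' hclN i f]
  funext x
  rw [truncatedKernelClass_def, truncatedKernelClass_def, hB]

/-- **`J^T_𝔬(f)` does not depend on `(ν, 𝓕)`** on `U(J₂)`. [cite: Rogawski1990, §2.2 (p. 13)] -/
theorem truncatedTraceClass_eq_of_isFundamentalDomain_two
    [MeasurableSpace (adelicUnipotent F E c 2)] [BorelSpace (adelicUnipotent F E c 2)]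
    [MeasurableSpace (quasiSplit F E c 2).Adelic]
    (μ : Measure (quasiSplit F E c 2).automorphicQuotient)
    (ν ν' : Measure (adelicUnipotent F E c 2)) [ν.IsHaarMeasure] [ν'.IsHaarMeasure]
    {𝓕 𝓕' : Set (adelicUnipotent F E c 2)}
    (h𝓕 : IsFundamentalDomain (rationalUnipotent F E c 2) 𝓕 ν)
    (h𝓕' : IsFundamentalDomain (rationalUnipotent F E c 2) 𝓕' ν')
    {cl : (quasiSplit F E c 2).arithmeticSubgroup → ι} (hclN : IsUnipotentInvariantOnBorel F E c 2 cl)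
    (T : ℝ≥0) (i : ι) (f : (quasiSplit F E c 2).Adelic → ℂ) :
    truncatedTraceClass μ ν 𝓕 T cl i f = truncatedTraceClass μ ν' 𝓕' T cl i f := by
  rw [truncatedTraceClass_def, truncatedTraceClass_def,
    truncatedKernelClass_eq_of_isFundamentalDomain_two ν ν' h𝓕 h𝓕' hclN T i f]

/-! ## §2 The coarse `𝔬`-expansion of `U(J₂)` at the CM pair, from per-class integrability -/

/-- **THE COARSE `𝔬`-EXPANSION `J^T(f) = Σ_{𝔬 ∈ S_f} J^T_𝔬(f)` OF `U(J₂)` AT THE CM PAIR `(L⁺, L, complexConj)`** for the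
characteristic-polynomial classes `cl = charpoly ∘ adelicVal` (Rogawski §2.2: «Then (2.1.1) is equal to `Σ J^T_𝔬(f)`»), granted the
per-class integrability `hint` of the `k^T_𝔬` (the `N = 2` LAW 1 class row). For every Haar measure `ν` of `N(𝔸)`, fundamental domain
`𝓕` of `N(F)`, automorphic measure `μ` and test function `f` there are the FINITE set `S_f` of classes meeting `tsupport f` and `T₀` such
that for all `T > T₀`: every `k^T_𝔬`, `𝔬 ∈ S_f`, is `μ`-integrable, `k^T = Σ_{𝔬 ∈ S_f} k^T_𝔬` pointwise (★
`truncatedKernel_eq_sum_truncatedKernelClass_of_tsupport_two`, the arbitrary `𝓕` moved to Tate's compactly contained line domain ★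
`isFundamentalDomain_image_traceZeroFundamentalDomain_two` and back by §1 and ★ `truncatedKernel_eq_of_isFundamentalDomain`), and
`J^T(f) = Σ_{𝔬 ∈ S_f} J^T_𝔬(f)` (★ `truncatedTrace_eq_sum_truncatedTraceClass`). [cite: Rogawski1990, §2.2 (p. 13)]
[cite: Arthur1978TraceFormulaI, Thm. 7.1] [cite: Shokranian1992, §5.2] -/
theorem truncatedTrace_eq_sum_truncatedTraceClass_charpoly_cm_two_of_integrable (L : Type) [Field L] [NumberField L]
    [IsCMField L]
    (hint : ∀ [MeasurableSpace (adelicUnipotent (↥(maximalRealSubfield L)) L (IsCMField.complexConj L) 2)]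
      [BorelSpace (adelicUnipotent (↥(maximalRealSubfield L)) L (IsCMField.complexConj L) 2)]
      (ν : Measure (adelicUnipotent (↥(maximalRealSubfield L)) L (IsCMField.complexConj L) 2)) [ν.IsHaarMeasure]
      (𝓕 : Set (adelicUnipotent (↥(maximalRealSubfield L)) L (IsCMField.complexConj L) 2)),
      IsFundamentalDomain (rationalUnipotent (↥(maximalRealSubfield L)) L (IsCMField.complexConj L) 2) 𝓕 ν →
      ∀ (μ : Measure (quasiSplit (↥(maximalRealSubfield L)) L (IsCMField.complexConj L) 2).automorphicQuotient)
        [(quasiSplit (↥(maximalRealSubfield L)) L (IsCMField.complexConj L) 2).IsAutomorphicMeasure μ]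
        (f : (quasiSplit (↥(maximalRealSubfield L)) L (IsCMField.complexConj L) 2).Adelic → ℂ),
        IsQuasiSplitTest (↥(maximalRealSubfield L)) L (IsCMField.complexConj L) 2 f →
        ∀ p : (AdeleRing (𝓞 L) L)[X], ∃ T₀ : ℝ≥0, ∀ T : ℝ≥0, T₀ < T →
          Integrable ((quasiSplit (↥(maximalRealSubfield L)) L (IsCMField.complexConj L) 2).quotFun (truncatedKernelClass ν 𝓕 T
            (fun γ : ↥(quasiSplit (↥(maximalRealSubfield L)) L (IsCMField.complexConj L) 2).arithmeticSubgroup =>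
              ((adelicVal (↥(maximalRealSubfield L)) L (IsCMField.complexConj L) 2 _ (γ : (quasiSplit (↥(maximalRealSubfield L)) L (IsCMField.complexConj L) 2).Adelic) :
                GL (Fin 2) (AdeleRing (𝓞 L) L)) : Matrix (Fin 2) (Fin 2) (AdeleRing (𝓞 L) L)).charpoly) p f)) μ) :
    ∀ [MeasurableSpace (adelicUnipotent (↥(maximalRealSubfield L)) L (IsCMField.complexConj L) 2)]
      [BorelSpace (adelicUnipotent (↥(maximalRealSubfield L)) L (IsCMField.complexConj L) 2)]
      (ν : Measure (adelicUnipotent (↥(maximalRealSubfield L)) L (IsCMField.complexConj L) 2)) [ν.IsHaarMeasure]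
      (𝓕 : Set (adelicUnipotent (↥(maximalRealSubfield L)) L (IsCMField.complexConj L) 2)),
      IsFundamentalDomain (rationalUnipotent (↥(maximalRealSubfield L)) L (IsCMField.complexConj L) 2) 𝓕 ν →
        ∀ (μ : Measure (quasiSplit (↥(maximalRealSubfield L)) L (IsCMField.complexConj L) 2).automorphicQuotient)
          [(quasiSplit (↥(maximalRealSubfield L)) L (IsCMField.complexConj L) 2).IsAutomorphicMeasure μ]
          (f : (quasiSplit (↥(maximalRealSubfield L)) L (IsCMField.complexConj L) 2).Adelic → ℂ),
          IsQuasiSplitTest (↥(maximalRealSubfield L)) L (IsCMField.complexConj L) 2 f →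
          ∃ S : Finset (AdeleRing (𝓞 L) L)[X], ∃ T₀ : ℝ≥0, ∀ T : ℝ≥0, T₀ < T →
            (∀ p ∈ S, Integrable ((quasiSplit (↥(maximalRealSubfield L)) L (IsCMField.complexConj L) 2).quotFun (truncatedKernelClass ν 𝓕 T
              (fun γ : ↥(quasiSplit (↥(maximalRealSubfield L)) L (IsCMField.complexConj L) 2).arithmeticSubgroup =>
                ((adelicVal (↥(maximalRealSubfield L)) L (IsCMField.complexConj L) 2 _ (γ : (quasiSplit (↥(maximalRealSubfield L)) L (IsCMField.complexConj L) 2).Adelic) :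
                  GL (Fin 2) (AdeleRing (𝓞 L) L)) : Matrix (Fin 2) (Fin 2) (AdeleRing (𝓞 L) L)).charpoly) p f)) μ) ∧
            (∀ x : (quasiSplit (↥(maximalRealSubfield L)) L (IsCMField.complexConj L) 2).Adelic, truncatedKernel ν 𝓕 T f x = ∑ p ∈ S, truncatedKernelClass ν 𝓕 T
              (fun γ : ↥(quasiSplit (↥(maximalRealSubfield L)) L (IsCMField.complexConj L) 2).arithmeticSubgroup =>
                ((adelicVal (↥(maximalRealSubfield L)) L (IsCMField.complexConj L) 2 _ (γ : (quasiSplit (↥(maximalRealSubfield L)) L (IsCMField.complexConj L) 2).Adelic) :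
                  GL (Fin 2) (AdeleRing (𝓞 L) L)) : Matrix (Fin 2) (Fin 2) (AdeleRing (𝓞 L) L)).charpoly) p f x) ∧
            truncatedTrace μ ν 𝓕 T f = ∑ p ∈ S, truncatedTraceClass μ ν 𝓕 T
              (fun γ : ↥(quasiSplit (↥(maximalRealSubfield L)) L (IsCMField.complexConj L) 2).arithmeticSubgroup =>
                ((adelicVal (↥(maximalRealSubfield L)) L (IsCMField.complexConj L) 2 _ (γ : (quasiSplit (↥(maximalRealSubfield L)) L (IsCMField.complexConj L) 2).Adelic) :
                  GL (Fin 2) (AdeleRing (𝓞 L) L)) : Matrix (Fin 2) (Fin 2) (AdeleRing (𝓞 L) L)).charpoly) p f := by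
  intro mN bN ν hν 𝓕 h𝓕 μ hμ f hf
  have hc : IsCMField.complexConj L * IsCMField.complexConj L = 1 := complexConj_mul_complexConj L
  have hij : (((0 : Fin 2) : Fin 2) : ℕ) + 1 = (((1 : Fin 2) : Fin 2) : ℕ) := rfl
  have hN2 : 2 = 2 * (((0 : Fin 2) : Fin 2) : ℕ) + 2 := rfl
  set cl : ↥(quasiSplit (↥(maximalRealSubfield L)) L (IsCMField.complexConj L) 2).arithmeticSubgroup → (AdeleRing (𝓞 L) L)[X] := fun γ =>
    ((adelicVal (↥(maximalRealSubfield L)) L (IsCMField.complexConj L) 2 _ (γ : (quasiSplit (↥(maximalRealSubfield L)) L (IsCMField.complexConj L) 2).Adelic) :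
      GL (Fin 2) (AdeleRing (𝓞 L) L)) : Matrix (Fin 2) (Fin 2) (AdeleRing (𝓞 L) L)).charpoly with hcl_def
  have hclN : IsUnipotentInvariantOnBorel (↥(maximalRealSubfield L)) L (IsCMField.complexConj L) 2 cl :=
    isUnipotentInvariantOnBorel_charpoly_adelicVal
  have hfc : Continuous f := hf.continuous'
  have hfs : HasCompactSupport f := hf.hasCompactSupport'
  -- Tate's fundamental domain on the line, compactly contained (FD-independence moves `𝓕` there and back)
  letI : MeasurableSpace (AdeleRing (𝓞 L) L) := borel _
  haveI : BorelSpace (AdeleRing (𝓞 L) L) := ⟨rfl⟩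
  set 𝓕₀ : Set (adelicUnipotent (↥(maximalRealSubfield L)) L (IsCMField.complexConj L) 2) :=
    (fun b : ↥(traceZeroAdele (↥(maximalRealSubfield L)) L (IsCMField.complexConj L)) =>
      middleRootUnipotent hij hN2 (Multiplicative.ofAdd b)) ''
      traceZeroFundamentalDomain (↥(maximalRealSubfield L)) L (IsCMField.complexConj L) with h𝓕₀_def
  have h𝓕₀ : IsFundamentalDomain (rationalUnipotent (↥(maximalRealSubfield L)) L (IsCMField.complexConj L) 2) 𝓕₀ ν :=
    isFundamentalDomain_image_traceZeroFundamentalDomain_two hij hN2 hc ν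
  obtain ⟨W₀, hW₀, h𝓕₀W₀⟩ := exists_isCompact_image_traceZeroFundamentalDomain_subset_two
    (F := ↥(maximalRealSubfield L)) (E := L) (c := IsCMField.complexConj L) hij hN2 hc
  -- the finite set of live classes
  set S : Finset (AdeleRing (𝓞 L) L)[X] := (finite_setOf_charpoly_eq_of_isCompact
    (F := ↥(maximalRealSubfield L)) (E := L) (c := IsCMField.complexConj L) (N := 2) hfs.isCompact).toFinset
    with hS_def
  -- per-class thresholds, maxed over the finite set
  have hint' := fun p => hint ν 𝓕 h𝓕 μ f hf p
  choose T₀ hT₀ using hint'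
  refine ⟨S, S.sup T₀, fun T hT => ?_⟩
  have hTpos : 0 < T := lt_of_le_of_lt bot_le hT
  have hintS : ∀ p ∈ S, Integrable ((quasiSplit (↥(maximalRealSubfield L)) L (IsCMField.complexConj L) 2).quotFun (truncatedKernelClass ν 𝓕 T cl p f)) μ :=
    fun p hp => hT₀ p T (lt_of_le_of_lt (Finset.le_sup hp) hT)
  -- the pointwise expansion at `𝓕₀`, transported to `𝓕`
  have hk₀ : ∀ x : (quasiSplit (↥(maximalRealSubfield L)) L (IsCMField.complexConj L) 2).Adelic,
      truncatedKernel ν 𝓕₀ T f x = ∑ p ∈ S, truncatedKernelClass ν 𝓕₀ T cl p f x :=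
    fun x => truncatedKernel_eq_sum_truncatedKernelClass_of_tsupport_two ν h𝓕₀ hW₀ h𝓕₀W₀ cl hfc hfs S hTpos
      (fun γ x hγ => (Set.Finite.mem_toFinset _).2 (charpoly_adelicVal_mem_setOf_of_conj_mem hγ))
      (fun β u y _ hβ => (Set.Finite.mem_toFinset _).2
        (charpoly_adelicVal_mem_setOf_of_conj_mul_mem β.2 u.2 hβ)) x
  have hkk : truncatedKernel ν 𝓕 T f = truncatedKernel ν 𝓕₀ T f :=
    truncatedKernel_eq_of_isFundamentalDomain ν ν h𝓕 h𝓕₀ T f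
  have hkc : ∀ p, truncatedKernelClass ν 𝓕 T cl p f = truncatedKernelClass ν 𝓕₀ T cl p f :=
    fun p => truncatedKernelClass_eq_of_isFundamentalDomain_two ν ν h𝓕 h𝓕₀ hclN T p f
  have hk : ∀ x : (quasiSplit (↥(maximalRealSubfield L)) L (IsCMField.complexConj L) 2).Adelic, truncatedKernel ν 𝓕 T f x = ∑ p ∈ S, truncatedKernelClass ν 𝓕 T cl p f x := by
    intro x
    rw [hkk, hk₀ x]
    exact Finset.sum_congr rfl fun p _ => by rw [hkc p]
  exact ⟨hintS, hk, truncatedTrace_eq_sum_truncatedTraceClass μ T cl S hk hintS⟩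


/-! ## ED. 2 — the hypothesis-free coarse expansion -/

/-- **(ED. 2) THE COARSE `𝔬`-EXPANSION `J^T(f) = Σ_{𝔬 ∈ S_f} J^T_𝔬(f)` OF `U(J₂)` AT THE CM PAIR — NO hypothesis**: §2 fed with the
`N = 2` LAW 1 class row ★ `truncatedKernelClassIntegrable_cm_two` (`UnitaryGroupTruncatedKernelClassIntegrableHoldsTwo`) at the
characteristic-polynomial class map (★ `isConjInvariant_charpoly_adelicVal`, ★ `isUnipotentInvariantOnBorel_charpoly_adelicVal`). The
`N = 2` twin of ★ `truncatedTrace_eq_sum_truncatedTraceClass_charpoly_cm`. [cite: Rogawski1990, §2.2 (p. 13)]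
[cite: Arthur1978TraceFormulaI, Thm. 7.1] [cite: Shokranian1992, §5.2] -/
theorem truncatedTrace_eq_sum_truncatedTraceClass_charpoly_two_cm (L : Type) [Field L] [NumberField L] [IsCMField L] :
    ∀ [MeasurableSpace (adelicUnipotent (↥(maximalRealSubfield L)) L (IsCMField.complexConj L) 2)]
      [BorelSpace (adelicUnipotent (↥(maximalRealSubfield L)) L (IsCMField.complexConj L) 2)]
      (ν : Measure (adelicUnipotent (↥(maximalRealSubfield L)) L (IsCMField.complexConj L) 2)) [ν.IsHaarMeasure]
      (𝓕 : Set (adelicUnipotent (↥(maximalRealSubfield L)) L (IsCMField.complexConj L) 2)),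
      IsFundamentalDomain (rationalUnipotent (↥(maximalRealSubfield L)) L (IsCMField.complexConj L) 2) 𝓕 ν →
        ∀ (μ : Measure (quasiSplit (↥(maximalRealSubfield L)) L (IsCMField.complexConj L) 2).automorphicQuotient)
          [(quasiSplit (↥(maximalRealSubfield L)) L (IsCMField.complexConj L) 2).IsAutomorphicMeasure μ]
          (f : (quasiSplit (↥(maximalRealSubfield L)) L (IsCMField.complexConj L) 2).Adelic → ℂ),
          IsQuasiSplitTest (↥(maximalRealSubfield L)) L (IsCMField.complexConj L) 2 f →
          ∃ S : Finset (AdeleRing (𝓞 L) L)[X], ∃ T₀ : ℝ≥0, ∀ T : ℝ≥0, T₀ < T →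
            (∀ p ∈ S, Integrable ((quasiSplit (↥(maximalRealSubfield L)) L (IsCMField.complexConj L) 2).quotFun (truncatedKernelClass ν 𝓕 T
              (fun γ : ↥(quasiSplit (↥(maximalRealSubfield L)) L (IsCMField.complexConj L) 2).arithmeticSubgroup =>
                ((adelicVal (↥(maximalRealSubfield L)) L (IsCMField.complexConj L) 2 _ (γ : (quasiSplit (↥(maximalRealSubfield L)) L (IsCMField.complexConj L) 2).Adelic) :
                  GL (Fin 2) (AdeleRing (𝓞 L) L)) : Matrix (Fin 2) (Fin 2) (AdeleRing (𝓞 L) L)).charpoly) p f)) μ) ∧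
            (∀ x : (quasiSplit (↥(maximalRealSubfield L)) L (IsCMField.complexConj L) 2).Adelic, truncatedKernel ν 𝓕 T f x = ∑ p ∈ S, truncatedKernelClass ν 𝓕 T
              (fun γ : ↥(quasiSplit (↥(maximalRealSubfield L)) L (IsCMField.complexConj L) 2).arithmeticSubgroup =>
                ((adelicVal (↥(maximalRealSubfield L)) L (IsCMField.complexConj L) 2 _ (γ : (quasiSplit (↥(maximalRealSubfield L)) L (IsCMField.complexConj L) 2).Adelic) :
                  GL (Fin 2) (AdeleRing (𝓞 L) L)) : Matrix (Fin 2) (Fin 2) (AdeleRing (𝓞 L) L)).charpoly) p f x) ∧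
            truncatedTrace μ ν 𝓕 T f = ∑ p ∈ S, truncatedTraceClass μ ν 𝓕 T
              (fun γ : ↥(quasiSplit (↥(maximalRealSubfield L)) L (IsCMField.complexConj L) 2).arithmeticSubgroup =>
                ((adelicVal (↥(maximalRealSubfield L)) L (IsCMField.complexConj L) 2 _ (γ : (quasiSplit (↥(maximalRealSubfield L)) L (IsCMField.complexConj L) 2).Adelic) :
                  GL (Fin 2) (AdeleRing (𝓞 L) L)) : Matrix (Fin 2) (Fin 2) (AdeleRing (𝓞 L) L)).charpoly) p f :=
  truncatedTrace_eq_sum_truncatedTraceClass_charpoly_cm_two_of_integrable L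
    (fun ν _ 𝓕 h𝓕 μ _ f hf p => truncatedKernelClassIntegrable_cm_two L isConjInvariant_charpoly_adelicVal
      isUnipotentInvariantOnBorel_charpoly_adelicVal ν 𝓕 h𝓕 μ f hf p)

end UnitaryGroup

end Literature.NumberTheory.Automorphic
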